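import Mathlib.Analysis.SpecialFunctions.Trigonometric.Inverse
import Mathlib.Analysis.SpecialFunctions.Trigonometric.Bounds
import Mathlib.Analysis.SpecialFunctions.Trigonometric.DerivHyp
import Literature.Probability.LatticeModels.MagnetizationExponentUpperAFe

/-!
# The tilted mean below the first Lee–Yang zero (stub `stub_tiltedMeanBelowFirstZero`, line `SketchPub`)

Crux `CoulombImpliesNontrivial` of route `PerfectScreening` (Ising3DConformalLimit), item
stmt-CriticalPhenomena-13885, registered stub T1a. Pure real analysis on one Lee–Yang package
`(m, b₁ … b_n)`, `bᵢ ≥ 1`: if Newman's first-zero bound `12/θ⁴ ≤ K` holds at every zero `θ > 0` of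
`cos^m θ ∏ᵢ (1 - bᵢ sin² θ)`, then for `0 ≤ t ≤ 1` with `π² √(K/12) sinh² t ≤ 2` the tilted mean
dominates half the linear response:

  `t (m + 2 Σ bᵢ) / 2 ≤ m tanh t + Σᵢ 2 bᵢ sinh t cosh t / (1 + bᵢ sinh² t)`.

Proof.
* `four_mul_le_pi_sq_mul_sqrt` (mode bound): `θᵢ = arcsin (1/√bᵢ) ∈ (0, π/2]` is a zero of the factor
  `1 - bᵢ sin² θ`, so `12/θᵢ⁴ ≤ K`; Jordan's inequality `(2/π) θᵢ ≤ sin θᵢ = 1/√bᵢ` gives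
  `bᵢ θᵢ² ≤ π²/4`, whence `192 bᵢ² ≤ K π⁴`, i.e. `4 bᵢ ≤ π² √(K/12)`. With the hypothesis,
  `bᵢ sinh² t ≤ 1/2`.
* the `m`-term: `t/2 ≤ tanh t` on `[0, 1]` (tree lemma `Literature.Probability.LatticeModels.half_le_tanh`).
* the `i`-terms: `2 bᵢ s c/(1 + bᵢ s²) ≥ 2 bᵢ s c/(3/2) ≥ bᵢ t` (`s = sinh t ≥ t`, `c = cosh t ≥ 1`).
-/

noncomputable section

namespace Summit.CriticalPhenomena.Ising3DConformalLimit.PerfectScreeningCoulombImpliesNontrivial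

open Real Finset
open scoped BigOperators

/-- **Mode bound** from Newman's first-zero inequality: if `b ≥ 1` and `12/θ⁴ ≤ K` at every zero `θ > 0`
of `1 - b sin² θ`, then `4 b ≤ π² √(K/12)` (the zero `θ = arcsin (1/√b) ∈ (0, π/2]` and Jordan's
inequality `(2/π) θ ≤ sin θ = 1/√b` give `b θ² ≤ π²/4`, so `192 b² ≤ K π⁴`). -/
theorem four_mul_le_pi_sq_mul_sqrt {b K : ℝ} (hb : 1 ≤ b)
    (hK : ∀ θ : ℝ, 0 < θ → 1 - b * Real.sin θ ^ 2 = 0 → 12 / θ ^ 4 ≤ K) :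
    4 * b ≤ π ^ 2 * Real.sqrt (K / 12) := by
  have hb0 : 0 < b := by linarith
  have hsb : 1 ≤ Real.sqrt b := Real.one_le_sqrt.mpr hb
  have hsb0 : 0 < Real.sqrt b := one_pos.trans_le hsb
  set x : ℝ := 1 / Real.sqrt b with hx
  have hx0 : 0 < x := by positivity
  have hx1 : x ≤ 1 := by rw [hx, div_le_one hsb0]; exact hsb
  set θ : ℝ := Real.arcsin x with hθ
  have hθ0 : 0 < θ := Real.arcsin_pos.mpr hx0
  have hθ1 : θ ≤ π / 2 := Real.arcsin_le_pi_div_two x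
  have hsin : Real.sin θ = x := Real.sin_arcsin (by linarith) hx1
  have hxb : x ^ 2 * b = 1 := by
    rw [hx, div_pow, one_pow, Real.sq_sqrt hb0.le]
    field_simp
  have hzero : 1 - b * Real.sin θ ^ 2 = 0 := by rw [hsin]; linarith
  have hKθ : 12 / θ ^ 4 ≤ K := hK θ hθ0 hzero
  have hK0 : 0 < K := lt_of_lt_of_le (by positivity) hKθ
  have hK12 : 12 ≤ K * θ ^ 4 := (div_le_iff₀ (by positivity)).mp hKθ
  -- Jordan: `(2/π) θ ≤ sin θ = x`, hence `4 b θ² ≤ π²`.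
  have hπ : 0 < π := Real.pi_pos
  have hj : 2 * θ ≤ π * x := by
    have h := Real.mul_le_sin hθ0.le hθ1
    rw [hsin, div_mul_eq_mul_div, div_le_iff₀ hπ] at h
    linarith
  have hsq : (2 * θ) ^ 2 ≤ (π * x) ^ 2 := pow_le_pow_left₀ (by positivity) hj 2
  have hbθ : 4 * (b * θ ^ 2) ≤ π ^ 2 := by
    have h1 : (2 * θ) ^ 2 * b ≤ (π * x) ^ 2 * b := mul_le_mul_of_nonneg_right hsq hb0.le
    have h2 : (π * x) ^ 2 * b = π ^ 2 := by rw [mul_pow, mul_assoc, hxb, mul_one]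
    nlinarith [h1, h2]
  -- `192 b² ≤ K π⁴`
  have hmain : 192 * b ^ 2 ≤ K * π ^ 4 := by
    have h1 : 16 * b ^ 2 * 12 ≤ 16 * b ^ 2 * (K * θ ^ 4) :=
      mul_le_mul_of_nonneg_left hK12 (by positivity)
    have h3 : (4 * (b * θ ^ 2)) ^ 2 ≤ (π ^ 2) ^ 2 := pow_le_pow_left₀ (by positivity) hbθ 2
    have h4 : K * (4 * (b * θ ^ 2)) ^ 2 ≤ K * (π ^ 2) ^ 2 := mul_le_mul_of_nonneg_left h3 hK0.le
    calc 192 * b ^ 2 = 16 * b ^ 2 * 12 := by ring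
      _ ≤ 16 * b ^ 2 * (K * θ ^ 4) := h1
      _ = K * (4 * (b * θ ^ 2)) ^ 2 := by ring
      _ ≤ K * (π ^ 2) ^ 2 := h4
      _ = K * π ^ 4 := by ring
  -- take square roots
  have hπ2 : 0 < π ^ 2 := by positivity
  have h5 : 4 * b / π ^ 2 ≤ Real.sqrt (K / 12) := by
    apply Real.le_sqrt_of_sq_le
    rw [div_pow, div_le_div_iff₀ (by positivity) (by norm_num)]
    nlinarith [hmain]
  rw [div_le_iff₀ hπ2] at h5
  linarith

/-- **T1a — the tilted mean below the first zero.** For a Lee–Yang package `(m, b)` with `bᵢ ≥ 1` whose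
cosine transform `cos^m θ ∏ (1 - bᵢ sin² θ)` obeys Newman's first-zero bound `12/θ⁴ ≤ K` at each of its
zeros `θ > 0`, and for `0 ≤ t ≤ 1` with `π² √(K/12) sinh² t ≤ 2`, the tilted mean
`m tanh t + Σ 2bᵢ sinh t cosh t/(1 + bᵢ sinh² t)` is at least half the linear response `t (m + 2Σbᵢ)`. -/
theorem stub_tiltedMeanBelowFirstZero :
    ∀ (m n : ℕ) (b : Fin n → ℝ) (K t : ℝ), (∀ i, 1 ≤ b i) →
      (∀ θ : ℝ, 0 < θ → Real.cos θ ^ m * ∏ i, (1 - b i * Real.sin θ ^ 2) = 0 → 12 / θ ^ 4 ≤ K) →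
      0 ≤ t → t ≤ 1 → Real.pi ^ 2 * Real.sqrt (K / 12) * Real.sinh t ^ 2 ≤ 2 →
      t * ((m : ℝ) + 2 * ∑ i, b i) / 2 ≤
        m * Real.tanh t + ∑ i, 2 * b i * Real.sinh t * Real.cosh t / (1 + b i * Real.sinh t ^ 2) := by
  intro m n b K t hb hK ht0 ht1 hcond
  set s : ℝ := Real.sinh t with hs
  set c : ℝ := Real.cosh t with hc
  have hs0 : 0 ≤ s := Real.sinh_nonneg_iff.2 ht0
  have hts : t ≤ s := Real.self_le_sinh_iff.2 ht0
  have hc1 : 1 ≤ c := Real.one_le_cosh t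
  -- (1) mode bound: `bᵢ sinh² t ≤ 1/2`
  have hmode : ∀ i, b i * s ^ 2 ≤ 1 / 2 := by
    intro i
    have h4 : 4 * b i ≤ π ^ 2 * Real.sqrt (K / 12) := by
      refine four_mul_le_pi_sq_mul_sqrt (hb i) fun θ hθ hz => hK θ hθ ?_
      have hprod : ∏ j, (1 - b j * Real.sin θ ^ 2) = 0 :=
        Finset.prod_eq_zero (Finset.mem_univ i) hz
      rw [hprod, mul_zero]
    have h4s : 4 * b i * s ^ 2 ≤ π ^ 2 * Real.sqrt (K / 12) * s ^ 2 :=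
      mul_le_mul_of_nonneg_right h4 (sq_nonneg s)
    linarith
  -- (2) the `m`-term: `m t/2 ≤ m tanh t`
  have hm_term : t * (m : ℝ) / 2 ≤ m * Real.tanh t := by
    have h := mul_le_mul_of_nonneg_left (Literature.Probability.LatticeModels.half_le_tanh ht0 ht1)
      (Nat.cast_nonneg m : (0 : ℝ) ≤ m)
    linarith
  -- (3) the `i`-terms: `bᵢ t ≤ 2 bᵢ s c/(1 + bᵢ s²)`
  have hi_term : ∀ i, t * b i ≤ 2 * b i * s * c / (1 + b i * s ^ 2) := by
    intro i
    have hbi : 0 ≤ b i := zero_le_one.trans (hb i)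
    have hD : 0 < 1 + b i * s ^ 2 := by positivity
    rw [le_div_iff₀ hD]
    have h1 : t * b i * (1 + b i * s ^ 2) ≤ t * b i * (3 / 2) :=
      mul_le_mul_of_nonneg_left (by linarith [hmode i]) (mul_nonneg ht0 hbi)
    have h2 : t ≤ s * c := by
      have := mul_le_mul_of_nonneg_left hc1 hs0
      linarith
    have h3 := mul_le_mul_of_nonneg_left h2 hbi
    nlinarith [mul_nonneg ht0 hbi]
  -- (4) add up
  have hsum : ∑ i, t * b i = t * ∑ i, b i := by rw [Finset.mul_sum]
  calc t * ((m : ℝ) + 2 * ∑ i, b i) / 2 = t * (m : ℝ) / 2 + ∑ i, t * b i := by rw [hsum]; ring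
    _ ≤ m * Real.tanh t + ∑ i, 2 * b i * s * c / (1 + b i * s ^ 2) :=
        add_le_add hm_term (Finset.sum_le_sum fun i _ => hi_term i)

end Summit.CriticalPhenomena.Ising3DConformalLimit.PerfectScreeningCoulombImpliesNontrivial

end
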